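import Literature.AlgebraicGeometry.Resolution.HenselizationHenselian
import Mathlib.FieldTheory.AlgebraicClosure
import Mathlib.Data.Finset.Order
import HarnessLib

/-!
# The henselization of a directed union; descent of henselization membership to finite levels

Topic: `Literature/AlgebraicGeometry/Resolution` (valued fields; henselization). Groundwork for
the assembly of M. Temkin, *Inseparable local uniformization*, J. Algebra 373 (2013) 65–119 =
arXiv:0804.1554v3, Thm. 3.3.1 (tree: the named fact `Temkin2013RelativeCurveSmoothFibre`,
`InseparableLocalUniformizationCurvesStepOne.lean`). The valuation-theoretic input of that
theorem (Thms. 3.2.3, 3.2.6) is produced over an INFINITE algebraic extension of the ground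
field `k` — the (completed, there; henselized, in the tree's ambient rendering) perfection
`k^{1/p^∞}` and the relative algebraic closure `L` of the ground field in the function field — and
is then brought down to a FINITE level: proof of Thm. 3.2.3, Step 1 ("the affinoid domain `C′_m`
can be defined already over a finite extension `l/k` … enlarge `l ⊂ k_m` so that `T′ ∈ 𝒜′_l`")
and Step 2 ("`K` coincides with `\overline{l(T)}` already for a `k`-finite subfield `l ↪ L`"),
and proof of Thm. 3.2.6, Step 2 ("`𝒜 ⊗_k k_p` is dense in `𝒜 \hat⊗_k k″ ⥲ l″{T}`. Hence we can
move `T` so that `T ∈ 𝒜 ⊗_k k_p`, and then `T ∈ 𝒜 ⊗_k k′` already for a `k`-finite subfield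
`k′ ⊂ k_p`"; pp. 24–26 of the held arXiv text). Read in henselizations inside one ambient valued
field `(Ω, V)` (`Henselization.lean`: `henselization V E` = the decomposition field of
`(E^sep|E, V ∩ E^sep)`), every such descent is an instance of ONE principle, proved here:

**the henselization of a directed union of subfields is the (directed) union of their
henselizations**, so that an element of `(⋃ᵢ Eᵢ)^h` — and any finite set of such elements —
already lies in some `Eᵢ^h`.

* `exists_forall_mem_of_directed` — finitely many elements of a directed union `⨆ᵢ Sᵢ` of
  subfields lie in one `Sᵢ` — PROVED (bookkeeping);
* `IsHenselianField.iSup_of_directed` — **a directed union of henselian subfields of `(Ω, V)` is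
  henselian** (for `V ∩ ⋃ᵢ Sᵢ`) — PROVED: an element `y` of an algebraic extension `L` of
  `H = ⋃ᵢ Sᵢ` is algebraic over a finite level `Sᵢ` (the coefficients of one polynomial), and two
  valuation rings of `L` over `V ∩ H` agree on the relative algebraic closure of `Sᵢ` in `L`
  (Mathlib's `algebraicClosure`), by the henselianity of `Sᵢ`; so they agree at `y`;
* `henselization_iSup_of_directed` — **`(⨆ᵢ Sᵢ)^h = ⨆ᵢ Sᵢ^h` for a directed family** (`Ω`
  algebraically closed) — PROVED: `≥` is monotonicity (`henselization_mono`); for `≤`, the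
  right-hand side is a directed union of henselian fields (`Kuhlmann2010HenselizationIsHenselian_holds`),
  hence henselian, and contains `⨆ᵢ Sᵢ`, so it contains the henselization
  (`henselization_le_of_isHenselianField`, the universal property in its ambient form);
  `mem_henselization_iSup_iff`, `exists_forall_mem_henselization_of_directed` — the elementwise
  and finite-set forms;
* finite LEVELS of an extension `k ≤ P` with parameters `A ⊆ Ω`: the subfields
  `k(s)(A) = Subfield.closure (k ∪ s ∪ A)`, `s` finite `⊆ P`, form a directed family with union
  `P(A) = Subfield.closure (P ∪ A)` (`directed_closure_levels`, `iSup_closure_levels`), whence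
  `exists_finset_forall_mem_closure_levels` (plain membership) and
  `exists_finset_forall_mem_henselization_closure_levels` — **finitely many elements of
  `P(A)^h` lie in `k(s)(A)^h` for one finite `s ⊆ P`** — PROVED; and the form for an inclusion
  `F ≤ P(A)^h` of a subfield `F` generated by a subset of `k(A)` and finitely many elements,
  `exists_finset_closure_le_henselization_closure_levels` — PROVED. (With `P = k^{1/p^∞} ∩ Ω'`-type
  perfections or `P = L` algebraic over them, and `A` = generators of the function field, the
  separable constants `y₁, …, y_r` and the coordinate `t`, these are the descents of Thms. 3.2.3
  and 3.2.6 quoted above.)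

All statements are [folklore] valuation theory (F.-V. Kuhlmann, Trans. AMS 362 (2010), §1.1 and
Lemma 2.2 for the vocabulary; O. Endler, *Valuation theory* (1972), §17 for the classical
background); no definitions, no named facts.

## Sources

* M. Temkin, *Inseparable local uniformization*, J. Algebra 373 (2013) 65–119 = arXiv:0804.1554:
  proofs of Thm. 3.2.3 (Steps 1–2) and of Thm. 3.2.6 (Step 2), pp. 24–26 of the held arXiv text —
  the uses. [Temkin2013]
* F.-V. Kuhlmann, *Elimination of ramification I*, Trans. AMS 362 (2010) = arXiv:1003.5678, §1.1,
  Lemmas 2.2–2.3, through the tree (`Henselization.lean`, `HenselizationHenselian.lean`).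
  [Kuhlmann2010]
-/

noncomputable section

namespace Literature.AlgebraicGeometry.Resolution

universe u

variable {Ω : Type u} [Field Ω] (V : ValuationSubring Ω)

/-! ### Directed unions of subfields -/

section DirectedUnion

variable {ι : Type*} [Nonempty ι] {S : ι → Subfield Ω}

omit V in
/-- Finitely many elements of a directed union of subfields lie in one of them. [folklore] -/
theorem exists_forall_mem_of_directed (hS : Directed (· ≤ ·) S) (t : Finset Ω)
    (ht : ∀ z ∈ t, z ∈ ⨆ i, S i) : ∃ i, ∀ z ∈ t, z ∈ S i := by
  classical
  have key : ∀ z : t, ∃ i, (z : Ω) ∈ S i := fun z =>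
    (Subfield.mem_iSup_of_directed hS).mp (ht z z.2)
  choose f hf using key
  obtain ⟨j, hj⟩ := hS.finset_le (t.attach.image f)
  exact ⟨j, fun z hz => hj (f ⟨z, hz⟩) (Finset.mem_image.mpr ⟨⟨z, hz⟩, Finset.mem_attach _ _, rfl⟩)
    (hf ⟨z, hz⟩)⟩

/-- **A directed union of henselian subfields is henselian.** If every `(Sᵢ, V ∩ Sᵢ)` is
henselian (`IsHenselianField`: the valuation extends uniquely to every algebraic extension) and
the family is directed, then `(⨆ᵢ Sᵢ, V ∩ ⨆ᵢ Sᵢ)` is henselian. [folklore] -/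
theorem IsHenselianField.iSup_of_directed (hS : Directed (· ≤ ·) S)
    (hH : ∀ i, IsHenselianField (S i) (V.comap (algebraMap (S i) Ω))) :
    IsHenselianField (↥(⨆ i, S i)) (V.comap (algebraMap (↥(⨆ i, S i)) Ω)) := by
  intro L _ _ hL O₁ O₂ h₁ h₂
  haveI := hL
  classical
  ext y
  -- a finite level over which `y` is algebraic
  obtain ⟨p, hp0, hpy⟩ := (Algebra.IsAlgebraic.isAlgebraic y : IsAlgebraic (↥(⨆ i, S i)) y)
  obtain ⟨i, hi⟩ := exists_forall_mem_of_directed hS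
    (p.support.image fun n => ((p.coeff n : ↥(⨆ i, S i)) : Ω)) (by
      intro z hz
      obtain ⟨n, -, rfl⟩ := Finset.mem_image.mp hz
      exact (p.coeff n).2)
  have hle : S i ≤ ⨆ i, S i := le_iSup S i
  letI algSH : Algebra (S i) (↥(⨆ i, S i)) := (Subfield.inclusion hle).toAlgebra
  letI algSL : Algebra (S i) L :=
    ((algebraMap (↥(⨆ i, S i)) L).comp (Subfield.inclusion hle)).toAlgebra
  haveI : IsScalarTower (S i) (↥(⨆ i, S i)) L := IsScalarTower.of_algebraMap_eq fun _ => rfl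
  -- `p` comes from `S i`
  have hlift : p ∈ Polynomial.lifts (algebraMap (S i) (↥(⨆ i, S i))) := by
    rw [Polynomial.lifts_iff_coeff_lifts]
    intro n
    by_cases hn : n ∈ p.support
    · exact ⟨⟨(p.coeff n : Ω), hi _ (Finset.mem_image.mpr ⟨n, hn, rfl⟩)⟩, Subtype.ext rfl⟩
    · rw [Polynomial.notMem_support_iff.mp hn]
      exact ⟨0, map_zero _⟩
  obtain ⟨q, hq⟩ := (Polynomial.mem_lifts p).mp hlift
  have hq0 : q ≠ 0 := by
    rintro rfl
    rw [Polynomial.map_zero] at hq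
    exact hp0 hq.symm
  have hyalg : IsAlgebraic (S i) y :=
    ⟨q, hq0, by rw [← Polynomial.aeval_map_algebraMap (↥(⨆ i, S i)), hq, hpy]⟩
  -- the two rings agree on the algebraic closure of `S i` in `L`
  let A : IntermediateField (S i) L := algebraicClosure (S i) L
  have hover : ∀ O : ValuationSubring L,
      O.comap (algebraMap (↥(⨆ i, S i)) L) = V.comap (algebraMap (↥(⨆ i, S i)) Ω) →
      (O.comap (algebraMap A L)).comap (algebraMap (S i) A) = V.comap (algebraMap (S i) Ω) := by
    intro O hO
    rw [ValuationSubring.comap_comap, ← IsScalarTower.algebraMap_eq,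
      IsScalarTower.algebraMap_eq (S i) (↥(⨆ i, S i)) L, ← ValuationSubring.comap_comap, hO,
      ValuationSubring.comap_comap]
    rfl
  have hA : O₁.comap (algebraMap A L) = O₂.comap (algebraMap A L) :=
    (hH i) A inferInstance _ _ (hover O₁ h₁) (hover O₂ h₂)
  have hyA : y ∈ A := mem_algebraicClosure_iff.mpr hyalg
  have key := SetLike.ext_iff.mp hA ⟨y, hyA⟩
  rwa [ValuationSubring.mem_comap, ValuationSubring.mem_comap] at key

variable [IsAlgClosed Ω]

omit [Nonempty ι] in
/-- The henselizations of a directed family form a directed family. [folklore] -/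
theorem directed_henselization (hS : Directed (· ≤ ·) S) :
    Directed (· ≤ ·) fun i => henselization V (S i) :=
  hS.mono_comp _ fun _ _ h => henselization_mono V Kuhlmann2010HenselizationIsHenselian_holds.{u} h

/-- **The henselization of a directed union is the union of the henselizations**:
`(⨆ᵢ Sᵢ)^h = ⨆ᵢ Sᵢ^h` inside `(Ω, V)`, `Ω` algebraically closed, for a directed family of
subfields. [folklore] -/
theorem henselization_iSup_of_directed (hS : Directed (· ≤ ·) S) :
    henselization V (⨆ i, S i) = ⨆ i, henselization V (S i) := by
  have hH := Kuhlmann2010HenselizationIsHenselian_holds.{u}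
  refine le_antisymm ?_ (iSup_le fun i => henselization_mono V hH (le_iSup S i))
  have hhens := IsHenselianField.iSup_of_directed V (directed_henselization V hS)
    fun i => hH Ω V (S i)
  exact henselization_le_of_isHenselianField V _
    (iSup_mono fun i => le_henselization V (S i)) hhens

/-- Membership form: `z ∈ (⨆ᵢ Sᵢ)^h ↔ z ∈ Sᵢ^h` for some `i`. [folklore] -/
theorem mem_henselization_iSup_iff (hS : Directed (· ≤ ·) S) {z : Ω} :
    z ∈ henselization V (⨆ i, S i) ↔ ∃ i, z ∈ henselization V (S i) := by
  rw [henselization_iSup_of_directed V hS,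
    Subfield.mem_iSup_of_directed (directed_henselization V hS)]

/-- **Finitely many elements of `(⨆ᵢ Sᵢ)^h` lie in one `Sᵢ^h`.** [folklore] -/
theorem exists_forall_mem_henselization_of_directed (hS : Directed (· ≤ ·) S) (t : Finset Ω)
    (ht : ∀ z ∈ t, z ∈ henselization V (⨆ i, S i)) :
    ∃ i, ∀ z ∈ t, z ∈ henselization V (S i) := by
  rw [henselization_iSup_of_directed V hS] at ht
  exact exists_forall_mem_of_directed (directed_henselization V hS) t ht

end DirectedUnion

/-! ### Finite levels of an extension `k ≤ P`, with parameters -/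

section Levels

variable {k P : Subfield Ω} (hkP : k ≤ P) (A : Set Ω)

omit V in
/-- The levels `k(s)(A)`, `s` finite `⊆ P`, form a directed family. [folklore] -/
theorem directed_closure_levels :
    Directed (· ≤ ·) fun s : {s : Finset Ω // (↑s : Set Ω) ⊆ P} =>
      Subfield.closure ((k : Set Ω) ∪ ↑s.1 ∪ A) := by
  classical
  intro s t
  refine ⟨⟨s.1 ∪ t.1, ?_⟩, ?_, ?_⟩
  · rw [Finset.coe_union]
    exact Set.union_subset s.2 t.2
  · refine Subfield.closure_mono ?_
    rw [Finset.coe_union]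
    exact Set.union_subset_union_left _ (Set.union_subset_union_right _ Set.subset_union_left)
  · refine Subfield.closure_mono ?_
    rw [Finset.coe_union]
    exact Set.union_subset_union_left _ (Set.union_subset_union_right _ Set.subset_union_right)

omit V in
include hkP in
/-- The union of the levels `k(s)(A)`, `s` finite `⊆ P`, is `P(A)`. [folklore] -/
theorem iSup_closure_levels :
    (⨆ s : {s : Finset Ω // (↑s : Set Ω) ⊆ P}, Subfield.closure ((k : Set Ω) ∪ ↑s.1 ∪ A)) =
      Subfield.closure ((P : Set Ω) ∪ A) := by
  classical
  refine le_antisymm (iSup_le fun s => Subfield.closure_mono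
    (Set.union_subset_union_left _ (Set.union_subset hkP s.2))) ?_
  refine Subfield.closure_le.mpr (Set.union_subset (fun x hx => ?_) fun a ha => ?_)
  · refine le_iSup (fun s : {s : Finset Ω // (↑s : Set Ω) ⊆ P} =>
      Subfield.closure ((k : Set Ω) ∪ ↑s.1 ∪ A)) ⟨{x}, by simpa using hx⟩ ?_
    exact Subfield.subset_closure (Set.mem_union_left _ (Set.mem_union_right _ (by simp)))
  · refine le_iSup (fun s : {s : Finset Ω // (↑s : Set Ω) ⊆ P} =>
      Subfield.closure ((k : Set Ω) ∪ ↑s.1 ∪ A)) ⟨∅, by simp⟩ ?_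
    exact Subfield.subset_closure (Set.mem_union_right _ ha)

omit V in
include hkP in
/-- **Plain descent**: finitely many elements of `P(A)` lie in one finite level `k(s)(A)`,
`s` finite `⊆ P`. [folklore] -/
theorem exists_finset_forall_mem_closure_levels (t : Finset Ω)
    (ht : ∀ z ∈ t, z ∈ Subfield.closure ((P : Set Ω) ∪ A)) :
    ∃ s : Finset Ω, (↑s : Set Ω) ⊆ P ∧ ∀ z ∈ t, z ∈ Subfield.closure ((k : Set Ω) ∪ ↑s ∪ A) := by
  haveI : Nonempty {s : Finset Ω // (↑s : Set Ω) ⊆ P} := ⟨⟨∅, by simp⟩⟩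
  rw [← iSup_closure_levels hkP A] at ht
  obtain ⟨s, hs⟩ := exists_forall_mem_of_directed (directed_closure_levels A) t ht
  exact ⟨s.1, s.2, hs⟩

include hkP in
/-- **Descent of henselization membership to a finite level**: finitely many elements of
`P(A)^h` lie in `k(s)(A)^h` for one finite `s ⊆ P` (`Ω` algebraically closed). [folklore] -/
theorem exists_finset_forall_mem_henselization_closure_levels [IsAlgClosed Ω] (t : Finset Ω)
    (ht : ∀ z ∈ t, z ∈ henselization V (Subfield.closure ((P : Set Ω) ∪ A))) :
    ∃ s : Finset Ω, (↑s : Set Ω) ⊆ P ∧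
      ∀ z ∈ t, z ∈ henselization V (Subfield.closure ((k : Set Ω) ∪ ↑s ∪ A)) := by
  haveI : Nonempty {s : Finset Ω // (↑s : Set Ω) ⊆ P} := ⟨⟨∅, by simp⟩⟩
  rw [← iSup_closure_levels hkP A] at ht
  obtain ⟨s, hs⟩ :=
    exists_forall_mem_henselization_of_directed V (directed_closure_levels A) t ht
  exact ⟨s.1, s.2, hs⟩

include hkP in
/-- **Descent of an inclusion `F ≤ P(A)^h` for a finitely generated `F`**: if `F` is generated
by a set `B ⊆ k(A)` — hence lying in every level — together with finitely many elements, and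
`F ≤ P(A)^h`, then `F ≤ k(s)(A)^h` for one finite `s ⊆ P`. [folklore] -/
theorem exists_finset_closure_le_henselization_closure_levels [IsAlgClosed Ω]
    {B : Set Ω} (hB : B ⊆ Subfield.closure ((k : Set Ω) ∪ A)) (t : Finset Ω)
    (ht : ∀ z ∈ t, z ∈ henselization V (Subfield.closure ((P : Set Ω) ∪ A))) :
    ∃ s : Finset Ω, (↑s : Set Ω) ⊆ P ∧
      Subfield.closure (B ∪ ↑t) ≤ henselization V (Subfield.closure ((k : Set Ω) ∪ ↑s ∪ A)) := by
  obtain ⟨s, hsP, hs⟩ := exists_finset_forall_mem_henselization_closure_levels V hkP A t ht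
  refine ⟨s, hsP, Subfield.closure_le.mpr (Set.union_subset (hB.trans ?_) fun z hz => hs z hz)⟩
  exact (Subfield.closure_mono (Set.union_subset_union_left _ Set.subset_union_left)).trans
    (le_henselization V _)

end Levels

end Literature.AlgebraicGeometry.Resolution

end
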